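import Summits.Ventures.DiscreteObjects.PP12.FlagOrbitMatrix

/-!
# PP(12), flag cell of order 3: the plain orbit-matrix statement is invariant under relabelling (kernel; symmetry for the engines)
Framing: lottery ticket; floor = certified bounds/negative ranges.

Cell pub-namedobj (venture DiscreteObjects), target (M), designs gen 16. `IsFlagOrbitMatrix ρ` (`FlagOrbitMatrix`, designs g15) is UNDECIDED for
`ρ = 2, 3, 4`; designs g15's DIMACS encoder needs SYMMETRY BREAKING before an UNSAT run is feasible (g15 HANDOFF (c)). This file records, in the
kernel, the relabelling symmetries of the PLAIN statement that such breaking may use: simultaneously on rows and columns — a permutation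
`σ` of the classes together with, per class `s`, a permutation `τ s` of its twelve triangles (acting on the c-line rows, the side rows AND the
triangle columns); independently — a permutation `ζ` of the `Z`-columns, a relabelling `(κ, υ)` of the T-line rows `(k, t) ↦ (κ k, υ k t)` and a
relabelling `(κ', υ')` of the T-point columns. `isFlagOrbitMatrix_relabel`: a solution relabelled is a solution (all targets of the plain system see
only the index kind and equalities; `gammaEntry`, the `Z`-zeros and the side diagonal are respected because the same `(σ, τ)` acts on side rows and
triangle columns). `noFlagOrbitMatrix_of_normalized`: if every solution has a relabelling in some normal form `N`, it suffices to refute normalized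
solutions. Nothing here asserts any census statement. No `sorry`, no new axioms.
-/

namespace Summit.Ventures.DiscreteObjects.PP12

open Finset

namespace FlagOrbit

variable {ρ : ℕ}

/-- relabelling of the rows: classes/triangles by `(σ, τ)`, T-line orbits by `(κ, υ)` -/
def reRow (σ : Equiv.Perm (Fin ρ)) (τ : Fin ρ → Equiv.Perm (Fin 12)) (κ : Equiv.Perm (Fin (12 - 3 * ρ)))
    (υ : Fin (12 - 3 * ρ) → Equiv.Perm (Fin 4)) : FRow ρ ≃ FRow ρ :=
  Equiv.sumCongr σ (Equiv.sumCongr (Equiv.prodShear σ τ) (Equiv.prodShear κ υ))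

/-- relabelling of the columns: `Z`-orbits by `ζ`, triangles by the SAME `(σ, τ)`, T-point orbits by `(κ', υ')` -/
def reCol (ζ : Equiv.Perm (Fin ρ)) (σ : Equiv.Perm (Fin ρ)) (τ : Fin ρ → Equiv.Perm (Fin 12)) (κ' : Equiv.Perm (Fin (12 - 3 * ρ)))
    (υ' : Fin (12 - 3 * ρ) → Equiv.Perm (Fin 4)) : FCol ρ ≃ FCol ρ :=
  Equiv.sumCongr ζ (Equiv.sumCongr (Equiv.prodShear σ τ) (Equiv.prodShear κ' υ'))

variable (σ : Equiv.Perm (Fin ρ)) (τ : Fin ρ → Equiv.Perm (Fin 12)) (κ : Equiv.Perm (Fin (12 - 3 * ρ))) (υ : Fin (12 - 3 * ρ) → Equiv.Perm (Fin 4))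
  (ζ : Equiv.Perm (Fin ρ)) (κ' : Equiv.Perm (Fin (12 - 3 * ρ))) (υ' : Fin (12 - 3 * ρ) → Equiv.Perm (Fin 4))

/-- inverse row relabelling on a c-line row -/
@[simp] theorem reRow_symm_inl (s : Fin ρ) : (reRow σ τ κ υ).symm (Sum.inl s) = Sum.inl (σ.symm s) := rfl
/-- inverse row relabelling on a side row -/
@[simp] theorem reRow_symm_side (s : Fin ρ) (i : Fin 12) :
    (reRow σ τ κ υ).symm (Sum.inr (Sum.inl (s, i))) = Sum.inr (Sum.inl (σ.symm s, (τ (σ.symm s)).symm i)) := rfl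
/-- inverse row relabelling on a T-line row -/
@[simp] theorem reRow_symm_T (k : Fin (12 - 3 * ρ)) (t : Fin 4) :
    (reRow σ τ κ υ).symm (Sum.inr (Sum.inr (k, t))) = Sum.inr (Sum.inr (κ.symm k, (υ (κ.symm k)).symm t)) := rfl
/-- inverse column relabelling on a `Z`-column -/
@[simp] theorem reCol_symm_inl (t : Fin ρ) : (reCol ζ σ τ κ' υ').symm (Sum.inl t) = Sum.inl (ζ.symm t) := rfl
/-- inverse column relabelling on a triangle column -/
@[simp] theorem reCol_symm_tri (s : Fin ρ) (i : Fin 12) :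
    (reCol ζ σ τ κ' υ').symm (Sum.inr (Sum.inl (s, i))) = Sum.inr (Sum.inl (σ.symm s, (τ (σ.symm s)).symm i)) := rfl
/-- inverse column relabelling on a T-point column -/
@[simp] theorem reCol_symm_T (j : Fin (12 - 3 * ρ)) (t : Fin 4) :
    (reCol ζ σ τ κ' υ').symm (Sum.inr (Sum.inr (j, t))) = Sum.inr (Sum.inr (κ'.symm j, (υ' (κ'.symm j)).symm t)) := rfl

/-- row totals are invariant -/
theorem rowSum_reRow_symm (r : FRow ρ) : rowSum ((reRow σ τ κ υ).symm r) = rowSum r := by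
  rcases r with s | ⟨s, i⟩ | ⟨k, t⟩ <;> rfl

/-- column totals are invariant -/
theorem colSum_reCol_symm (c : FCol ρ) : colSum ((reCol ζ σ τ κ' υ').symm c) = colSum c := by
  rcases c with t | ⟨s, i⟩ | ⟨j, t⟩ <;> rfl

/-- an equivalence built by `prodShear` is injective on pairs: equality test -/
theorem shear_pair_eq_iff {α β : Type*} (e : Equiv.Perm α) (f : α → Equiv.Perm β) (a a' : α) (b b' : β) :
    ((e.symm a, (f (e.symm a)).symm b) = (e.symm a', (f (e.symm a')).symm b')) ↔ (a, b) = (a', b') := by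
  constructor
  · intro h
    have h1 : e.symm a = e.symm a' := congrArg Prod.fst h
    have ha : a = a' := e.symm.injective h1
    subst ha
    have h2 := congrArg Prod.snd h
    simp only at h2
    exact Prod.ext rfl ((f (e.symm a)).symm.injective h2)
  · intro h; cases h; rfl

/-- row targets are invariant -/
theorem rowTarget_reRow_symm (r r' : FRow ρ) : rowTarget ((reRow σ τ κ υ).symm r) ((reRow σ τ κ υ).symm r') = rowTarget r r' := by
  rcases r with s | ⟨s, i⟩ | ⟨k, t⟩ <;> rcases r' with s' | ⟨s', i'⟩ | ⟨k', t'⟩ <;>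
    simp only [reRow_symm_inl, reRow_symm_side, reRow_symm_T, rowTarget, σ.symm.injective.eq_iff, κ.symm.injective.eq_iff, shear_pair_eq_iff]

/-- column targets are invariant -/
theorem colTarget_reCol_symm (c c' : FCol ρ) :
    colTarget ((reCol ζ σ τ κ' υ').symm c) ((reCol ζ σ τ κ' υ').symm c') = colTarget c c' := by
  rcases c with t | ⟨s, i⟩ | ⟨j, t⟩ <;> rcases c' with t' | ⟨s', i'⟩ | ⟨j', t'⟩ <;>
    simp only [reCol_symm_inl, reCol_symm_tri, reCol_symm_T, colTarget, ζ.symm.injective.eq_iff, κ'.symm.injective.eq_iff, shear_pair_eq_iff]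

/-- the c-line rows are respected -/
theorem gammaEntry_relabel (s : Fin ρ) (c : FCol ρ) : gammaEntry (σ.symm s) ((reCol ζ σ τ κ' υ').symm c) = gammaEntry s c := by
  rcases c with t | ⟨s', i⟩ | ⟨j, t⟩ <;> simp only [reCol_symm_inl, reCol_symm_tri, reCol_symm_T, gammaEntry, σ.symm.injective.eq_iff]

end FlagOrbit

/-- **the relabelled matrix** -/
def flagRelabel {ρ : ℕ} (σ : Equiv.Perm (Fin ρ)) (τ : Fin ρ → Equiv.Perm (Fin 12)) (κ : Equiv.Perm (Fin (12 - 3 * ρ)))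
    (υ : Fin (12 - 3 * ρ) → Equiv.Perm (Fin 4)) (ζ : Equiv.Perm (Fin ρ)) (κ' : Equiv.Perm (Fin (12 - 3 * ρ)))
    (υ' : Fin (12 - 3 * ρ) → Equiv.Perm (Fin 4)) (M : FRow ρ → FCol ρ → ℕ) : FRow ρ → FCol ρ → ℕ :=
  fun r c => M ((FlagOrbit.reRow σ τ κ υ).symm r) ((FlagOrbit.reCol ζ σ τ κ' υ').symm c)

/-- **`IsFlagOrbitMatrix ρ` is invariant under relabelling.** -/
theorem isFlagOrbitMatrix_relabel {ρ : ℕ} {M : FRow ρ → FCol ρ → ℕ} (h : IsFlagOrbitMatrix ρ M) (σ : Equiv.Perm (Fin ρ))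
    (τ : Fin ρ → Equiv.Perm (Fin 12)) (κ : Equiv.Perm (Fin (12 - 3 * ρ))) (υ : Fin (12 - 3 * ρ) → Equiv.Perm (Fin 4)) (ζ : Equiv.Perm (Fin ρ))
    (κ' : Equiv.Perm (Fin (12 - 3 * ρ))) (υ' : Fin (12 - 3 * ρ) → Equiv.Perm (Fin 4)) :
    IsFlagOrbitMatrix ρ (flagRelabel σ τ κ υ ζ κ' υ' M) := by
  obtain ⟨h1, h2, h3, h4, h5, h6, h7⟩ := h
  set eR := FlagOrbit.reRow σ τ κ υ with heR
  set eC := FlagOrbit.reCol ζ σ τ κ' υ' with heC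
  refine ⟨fun r => ?_, fun c => ?_, fun r r' => ?_, fun c c' => ?_, fun s c => ?_, fun kt t => ?_, fun x => ?_⟩
  · simp only [flagRelabel]
    rw [Equiv.sum_comp eC.symm (fun c => M (eR.symm r) c), h1, FlagOrbit.rowSum_reRow_symm]
  · simp only [flagRelabel]
    rw [Equiv.sum_comp eR.symm (fun r => M r (eC.symm c)), h2, FlagOrbit.colSum_reCol_symm]
  · simp only [flagRelabel]
    rw [Equiv.sum_comp eC.symm (fun c => M (eR.symm r) c * M (eR.symm r') c), h3, FlagOrbit.rowTarget_reRow_symm]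
  · simp only [flagRelabel]
    rw [Equiv.sum_comp eR.symm (fun r => M r (eC.symm c) * M r (eC.symm c')), h4, FlagOrbit.colTarget_reCol_symm]
  · simp only [flagRelabel, FlagOrbit.reRow_symm_inl]
    rw [h5, FlagOrbit.gammaEntry_relabel]
  · obtain ⟨k, t'⟩ := kt
    simp only [flagRelabel, FlagOrbit.reRow_symm_T, FlagOrbit.reCol_symm_inl]
    exact h6 _ _
  · obtain ⟨s, i⟩ := x
    simp only [flagRelabel, FlagOrbit.reRow_symm_side, FlagOrbit.reCol_symm_tri]
    exact h7 _

/-- **Symmetry breaking is sound:** if every solution has a relabelling satisfying a normal form `N`, refuting normalized solutions refutes all. -/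
theorem noFlagOrbitMatrix_of_normalized {ρ : ℕ} (N : (FRow ρ → FCol ρ → ℕ) → Prop)
    (hN : ∀ M, IsFlagOrbitMatrix ρ M → ∃ (σ : Equiv.Perm (Fin ρ)) (τ : Fin ρ → Equiv.Perm (Fin 12)) (κ : Equiv.Perm (Fin (12 - 3 * ρ)))
      (υ : Fin (12 - 3 * ρ) → Equiv.Perm (Fin 4)) (ζ : Equiv.Perm (Fin ρ)) (κ' : Equiv.Perm (Fin (12 - 3 * ρ)))
      (υ' : Fin (12 - 3 * ρ) → Equiv.Perm (Fin 4)), N (flagRelabel σ τ κ υ ζ κ' υ' M))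
    (h : ∀ M, N M → ¬ IsFlagOrbitMatrix ρ M) : NoFlagOrbitMatrix ρ := by
  intro M hM
  obtain ⟨σ, τ, κ, υ, ζ, κ', υ', hNM⟩ := hN M hM
  exact h _ hNM (isFlagOrbitMatrix_relabel hM σ τ κ υ ζ κ' υ')

end Summit.Ventures.DiscreteObjects.PP12
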